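import Literature.IUT.HodgeTheaters.TemperedCoveringsCharts
import Literature.IUT.HodgeTheaters.TemperedCoveringsNodNon
import Literature.AnabelianGeometry.SemiGraphs.TemperedCompactPreimageCountable
import HarnessLib

/-!
# [IUTchI] Prop. 2.1 / Prop. 2.2 / Rmk. 2.2.2 for `TemperedGraphGroupData` — WITHOUT the (RF) binder

Mochizuki, *Inter-universal Teichmüller theory I*, §2, Prop. 2.1 (profinite conjugates of nontrivial
compact subgroups), Prop. 2.2 ("`Π^tp_𝔾` is commensurably terminal in `Π̂_𝔾`"), Rmk. 2.2.2, kurims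
pp. 45–46 [cite: Mochizuki2012, Prop 2.1 p.45] (claim key, DISPUTED corpus; typed ≠ endorsed).

Proof-only companion of `TemperedCoveringsProTree.lean` / `TemperedCoveringsNodNon.lean` /
`TemperedCoveringsCharts.lean` (abc-iut-L5-t11 lineage).  There, step (A0) ("`γ·Λ·γ⁻¹` is a compact
subgroup of `Π^tp_𝔾`") is supplied by `IsTempered.isCompact_comap` under the residual hypothesis (RF)
("open normal subgroups of `Π^tp_𝔾` closed for the `Π̂_𝔾`-topology are cofinal" = residual-`Σ̂`-ness of
the virtually free quotients `Gal(𝔾_{∞,i}/𝔾)`, flagged "for general `Σ̂` an input the instantiation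
must supply").  Here (RF) is REPLACED by first countability of `Π^tp_𝔾` — Galois-countability,
[IUTchI] Rmk. 2.5.3 (i) (T1)/(T6), which every `TemperedPiChart` records — via
`IsTempered.isCompact_comap_of_firstCountable` (open mapping theorem for tempered groups).  For the
chart-based forms the binder disappears altogether.  Nothing in the parent files is edited.
-/

noncomputable section

namespace Literature.IUT.HodgeTheaters

open Pointwise Filter
open _root_.Topology
open Literature.AnabelianGeometry.SemiGraphs (IsTempered IsProfiniteCompletion PSCDatum ProfiniteSemiGraph)
open Literature.AnabelianGeometry.SemiGraphs.ProfiniteSemiGraph (TemperedPiChart verticialSubgroups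
  CompactInVerticial VerticialInjective)
open Literature.AnabelianGeometry.AbsoluteAnabelian (IsCommensurablyTerminal)

universe u

namespace TemperedGraphGroupData

variable (D : TemperedGraphGroupData.{u})

/-- **Prop. 2.1 for `D` from temperedness + first countability of `Π^tp_𝔾`** (no (RF)):
`prop21_of_cosetTree` with (A0) discharged by `IsTempered.isCompact_comap_of_firstCountable`;
remaining inputs (A1), (A3) and the node data exactly as in `prop21_of_cosetTree_of_isTempered`.
([IUTchI] Prop 2.1 p.45) [claim: Mochizuki2012, status: disputed] -/
theorem prop21_of_cosetTree_of_firstCountable [T2Space D.Hat] (hT : IsTempered D.Tp)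
    [FirstCountableTopology D.Tp]
    {V : Type*} (Λv : V → Subgroup D.Tp) {E : Type*} (src tgt : E → V) (c₁ c₂ : E → D.Tp)
    (hA1 : ∀ Λ : Subgroup D.Tp, IsCompact (Λ : Set D.Tp) → Λ ≠ ⊥ →
      ∃ (v : V) (t : D.Tp), Λ ≤ MulAut.conj t • Λv v)
    (hA3 : ∀ (v w : V) (g h : D.Hat),
      MulAut.conj g • (Λv v).map D.ι ⊓ MulAut.conj h • (Λv w).map D.ι ≠ ⊥ →
        (v = w ∧ g⁻¹ * h ∈ (Λv v).map D.ι) ∨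
        ∃ (e : E) (k : D.Hat), ∃ p ∈ (Λv (src e)).map D.ι, ∃ q ∈ (Λv (tgt e)).map D.ι,
          (src e = v ∧ tgt e = w ∧ g = k * D.ι (c₁ e) * p ∧ h = k * D.ι (c₂ e) * q) ∨
          (src e = w ∧ tgt e = v ∧ h = k * D.ι (c₁ e) * p ∧ g = k * D.ι (c₂ e) * q)) :
    D.ProfiniteConjugatesOfCompactSubgroups :=
  D.prop21_of_cosetTree
    (hT.isCompact_comap_of_firstCountable D.ι D.ι_continuous D.ι_injective) Λv src tgt c₁ c₂ hA1 hA3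

/-- **Prop. 2.2, "`Π^tp_𝔾` is commensurably terminal in `Π̂_𝔾`", from temperedness + first
countability** (no (RF)): as `tp_isCommensurablyTerminal_of_cosetTree` with (A0) discharged by
`IsTempered.isCompact_comap_of_firstCountable`. ([IUTchI] Prop 2.2 p.45) [claim: Mochizuki2012, status: disputed] -/
theorem tp_isCommensurablyTerminal_of_cosetTree_of_firstCountable [T2Space D.Hat]
    (hT : IsTempered D.Tp) [FirstCountableTopology D.Tp]
    {V : Type*} (Λv : V → Subgroup D.Tp) {E : Type*} (src tgt : E → V) (c₁ c₂ : E → D.Tp)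
    (hA1 : ∀ Λ : Subgroup D.Tp, IsCompact (Λ : Set D.Tp) → Λ ≠ ⊥ →
      ∃ (v : V) (t : D.Tp), Λ ≤ MulAut.conj t • Λv v)
    (hA3 : ∀ (v w : V) (g h : D.Hat),
      MulAut.conj g • (Λv v).map D.ι ⊓ MulAut.conj h • (Λv w).map D.ι ≠ ⊥ →
        (v = w ∧ g⁻¹ * h ∈ (Λv v).map D.ι) ∨
        ∃ (e : E) (k : D.Hat), ∃ p ∈ (Λv (src e)).map D.ι, ∃ q ∈ (Λv (tgt e)).map D.ι,
          (src e = v ∧ tgt e = w ∧ g = k * D.ι (c₁ e) * p ∧ h = k * D.ι (c₂ e) * q) ∨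
          (src e = w ∧ tgt e = v ∧ h = k * D.ι (c₁ e) * p ∧ g = k * D.ι (c₂ e) * q))
    (v₀ : V) (hv₀c : IsCompact ((Λv v₀ : Subgroup D.Tp) : Set D.Tp))
    (hv₀inf : ((Λv v₀ : Subgroup D.Tp) : Set D.Tp).Infinite) :
    IsCommensurablyTerminal D.ι.range := by
  haveI : T2Space D.Tp := hT.t2Space
  exact D.tp_isCommensurablyTerminal_of_prop21'
    (D.prop21_of_cosetTree_of_firstCountable hT Λv src tgt c₁ c₂ hA1 hA3) ⟨Λv v₀, hv₀c, hv₀inf⟩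

/-- **Prop. 2.1 for `D`, (A3) BY NAME from [NodNon] Lemma 1.9 (ii)**, from temperedness + first
countability of `Π^tp_𝔾` (no (RF)): as `prop21_of_psc`. ([IUTchI] Prop 2.1 p.45)
[claim: Mochizuki2012, status: disputed] -/
theorem prop21_of_psc_of_firstCountable [T2Space D.Hat] (hT : IsTempered D.Tp)
    [FirstCountableTopology D.Tp]
    (G : PSCDatum D.Hat) (hNN : G.VerticialIntersectionNear)
    (Λv : G.graph.V → Subgroup D.Tp) (hΛv : ∀ v, (Λv v).map D.ι = G.vertGp v)
    (src tgt : G.graph.N → G.graph.V) (c₁ c₂ : G.graph.N → D.Tp)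
    (hends : ∀ e, G.graph.nodeEnds e = s(src e, tgt e))
    (h₁ : ∀ e, G.nodeGp e ≤ MulAut.conj (D.ι (c₁ e)) • G.vertGp (src e))
    (h₂ : ∀ e, G.nodeGp e ≤ MulAut.conj (D.ι (c₂ e)) • G.vertGp (tgt e))
    (hloop : ∀ e, src e = tgt e → (c₁ e)⁻¹ * c₂ e ∉ Λv (src e))
    (hA1 : ∀ Λ : Subgroup D.Tp, IsCompact (Λ : Set D.Tp) → Λ ≠ ⊥ →
      ∃ (v : G.graph.V) (t : D.Tp), Λ ≤ MulAut.conj t • Λv v) :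
    D.ProfiniteConjugatesOfCompactSubgroups :=
  D.prop21_of_cosetTree_of_firstCountable hT Λv src tgt c₁ c₂ hA1
    (D.hA3_of_verticialIntersectionNear G hNN Λv hΛv src tgt c₁ c₂ hends h₁ h₂ hloop)

/-- **Prop. 2.2 ("`Π^tp_𝔾` commensurably terminal in `Π̂_𝔾`"), (A3) BY NAME from [NodNon] Lemma
1.9 (ii)**, from temperedness + first countability (no (RF)): as `tp_isCommensurablyTerminal_of_psc`.
([IUTchI] Prop 2.2 p.45) [claim: Mochizuki2012, status: disputed] -/
theorem tp_isCommensurablyTerminal_of_psc_of_firstCountable [T2Space D.Hat] (hT : IsTempered D.Tp)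
    [FirstCountableTopology D.Tp]
    (G : PSCDatum D.Hat) (hNN : G.VerticialIntersectionNear)
    (Λv : G.graph.V → Subgroup D.Tp) (hΛv : ∀ v, (Λv v).map D.ι = G.vertGp v)
    (src tgt : G.graph.N → G.graph.V) (c₁ c₂ : G.graph.N → D.Tp)
    (hends : ∀ e, G.graph.nodeEnds e = s(src e, tgt e))
    (h₁ : ∀ e, G.nodeGp e ≤ MulAut.conj (D.ι (c₁ e)) • G.vertGp (src e))
    (h₂ : ∀ e, G.nodeGp e ≤ MulAut.conj (D.ι (c₂ e)) • G.vertGp (tgt e))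
    (hloop : ∀ e, src e = tgt e → (c₁ e)⁻¹ * c₂ e ∉ Λv (src e))
    (hA1 : ∀ Λ : Subgroup D.Tp, IsCompact (Λ : Set D.Tp) → Λ ≠ ⊥ →
      ∃ (v : G.graph.V) (t : D.Tp), Λ ≤ MulAut.conj t • Λv v)
    (v₀ : G.graph.V) (hv₀c : IsCompact ((Λv v₀ : Subgroup D.Tp) : Set D.Tp))
    (hv₀inf : ((Λv v₀ : Subgroup D.Tp) : Set D.Tp).Infinite) :
    IsCommensurablyTerminal D.ι.range :=
  D.tp_isCommensurablyTerminal_of_cosetTree_of_firstCountable hT Λv src tgt c₁ c₂ hA1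
    (D.hA3_of_verticialIntersectionNear G hNN Λv hΛv src tgt c₁ c₂ hends h₁ h₂ hloop) v₀ hv₀c hv₀inf

/-- **Rmk. 2.2.2 (normal terminality of `Π^tp_𝔾` in `Π̂_𝔾`), (A3) BY NAME**, from temperedness +
first countability (no (RF)): as `temperedNormallyTerminal_of_psc`. ([IUTchI] Rmk 2.2.2 p.46)
[claim: Mochizuki2012, status: disputed] -/
theorem temperedNormallyTerminal_of_psc_of_firstCountable [T2Space D.Hat] (hT : IsTempered D.Tp)
    [FirstCountableTopology D.Tp]
    (G : PSCDatum D.Hat) (hNN : G.VerticialIntersectionNear)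
    (Λv : G.graph.V → Subgroup D.Tp) (hΛv : ∀ v, (Λv v).map D.ι = G.vertGp v)
    (src tgt : G.graph.N → G.graph.V) (c₁ c₂ : G.graph.N → D.Tp)
    (hends : ∀ e, G.graph.nodeEnds e = s(src e, tgt e))
    (h₁ : ∀ e, G.nodeGp e ≤ MulAut.conj (D.ι (c₁ e)) • G.vertGp (src e))
    (h₂ : ∀ e, G.nodeGp e ≤ MulAut.conj (D.ι (c₂ e)) • G.vertGp (tgt e))
    (hloop : ∀ e, src e = tgt e → (c₁ e)⁻¹ * c₂ e ∉ Λv (src e))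
    (hA1 : ∀ Λ : Subgroup D.Tp, IsCompact (Λ : Set D.Tp) → Λ ≠ ⊥ →
      ∃ (v : G.graph.V) (t : D.Tp), Λ ≤ MulAut.conj t • Λv v)
    (v₀ : G.graph.V) (hv₀c : IsCompact ((Λv v₀ : Subgroup D.Tp) : Set D.Tp))
    (hv₀inf : ((Λv v₀ : Subgroup D.Tp) : Set D.Tp).Infinite) :
    D.TemperedNormallyTerminal :=
  ⟨fun _ => (D.tp_isCommensurablyTerminal_of_psc_of_firstCountable hT G hNN Λv hΛv src tgt c₁ c₂
    hends h₁ h₂ hloop hA1 v₀ hv₀c hv₀inf).isNormallyTerminal⟩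

/-- **Prop. 2.1 for `D` with `Π^tp_𝔾` a tempered fundamental group CHART of `𝒢`** — NO (RF) binder at
all: the chart supplies temperedness AND Galois-countability (`TemperedPiChart.secondCountableTopology`,
transported along `e : Π^tp_𝔾 ≃ₜ* π₁^temp(𝒢)`); otherwise as `prop21_of_chart`.
([IUTchI] Prop 2.1 p.45) [claim: Mochizuki2012, status: disputed] -/
theorem prop21_of_chart' {𝒢 : ProfiniteSemiGraph.{u}} [T2Space D.Hat] (c : TemperedPiChart 𝒢)
    (e : D.Tp ≃ₜ* c.G) (h𝒢 : 𝒢.Thm37Hypotheses) (hCV : CompactInVerticial.{u})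
    (Λv : 𝒢.graph.Vertex → Subgroup D.Tp)
    (hΛv : ∀ v, (Λv v).map (e : D.Tp →* c.G) ∈ verticialSubgroups c v)
    {E : Type*} (src tgt : E → 𝒢.graph.Vertex) (c₁ c₂ : E → D.Tp)
    (hA3 : ∀ (v w : 𝒢.graph.Vertex) (g h : D.Hat),
      MulAut.conj g • (Λv v).map D.ι ⊓ MulAut.conj h • (Λv w).map D.ι ≠ ⊥ →
        (v = w ∧ g⁻¹ * h ∈ (Λv v).map D.ι) ∨
        ∃ (e : E) (k : D.Hat), ∃ p ∈ (Λv (src e)).map D.ι, ∃ q ∈ (Λv (tgt e)).map D.ι,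
          (src e = v ∧ tgt e = w ∧ g = k * D.ι (c₁ e) * p ∧ h = k * D.ι (c₂ e) * q) ∨
          (src e = w ∧ tgt e = v ∧ h = k * D.ι (c₁ e) * p ∧ g = k * D.ι (c₂ e) * q)) :
    D.ProfiniteConjugatesOfCompactSubgroups := by
  haveI := c.secondCountableTopology
  haveI : SecondCountableTopology D.Tp := e.toHomeomorph.secondCountableTopology
  exact D.prop21_of_cosetTree_of_firstCountable (D.isTempered_tp_of_chart c e) Λv src tgt c₁ c₂
    (fun Λ hΛc _ => D.conj_le_of_compactInVerticial c e h𝒢 hCV Λv hΛv Λ hΛc) hA3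

/-- **Prop. 2.2 ("`Π^tp_𝔾` commensurably terminal in `Π̂_𝔾`") with `Π^tp_𝔾` a CHART of `𝒢`** — NO (RF)
binder; otherwise as `tp_isCommensurablyTerminal_of_chart`. ([IUTchI] Prop 2.2 p.45)
[claim: Mochizuki2012, status: disputed] -/
theorem tp_isCommensurablyTerminal_of_chart' {𝒢 : ProfiniteSemiGraph.{u}} [T2Space D.Hat]
    (c : TemperedPiChart 𝒢) (e : D.Tp ≃ₜ* c.G) (h𝒢 : 𝒢.Thm37Hypotheses)
    (hCV : CompactInVerticial.{u}) (hVI : VerticialInjective.{u})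
    (Λv : 𝒢.graph.Vertex → Subgroup D.Tp)
    (hΛv : ∀ v, (Λv v).map (e : D.Tp →* c.G) ∈ verticialSubgroups c v)
    {E : Type*} (src tgt : E → 𝒢.graph.Vertex) (c₁ c₂ : E → D.Tp)
    (hA3 : ∀ (v w : 𝒢.graph.Vertex) (g h : D.Hat),
      MulAut.conj g • (Λv v).map D.ι ⊓ MulAut.conj h • (Λv w).map D.ι ≠ ⊥ →
        (v = w ∧ g⁻¹ * h ∈ (Λv v).map D.ι) ∨
        ∃ (e : E) (k : D.Hat), ∃ p ∈ (Λv (src e)).map D.ι, ∃ q ∈ (Λv (tgt e)).map D.ι,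
          (src e = v ∧ tgt e = w ∧ g = k * D.ι (c₁ e) * p ∧ h = k * D.ι (c₂ e) * q) ∨
          (src e = w ∧ tgt e = v ∧ h = k * D.ι (c₁ e) * p ∧ g = k * D.ι (c₂ e) * q)) :
    IsCommensurablyTerminal D.ι.range := by
  haveI := c.secondCountableTopology
  haveI : SecondCountableTopology D.Tp := e.toHomeomorph.secondCountableTopology
  obtain ⟨v₀, hv₀c, hv₀inf⟩ := D.exists_infinite_compact_of_chart c e h𝒢 hVI Λv hΛv
  exact D.tp_isCommensurablyTerminal_of_cosetTree_of_firstCountable (D.isTempered_tp_of_chart c e)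
    Λv src tgt c₁ c₂ (fun Λ hΛc _ => D.conj_le_of_compactInVerticial c e h𝒢 hCV Λv hΛv Λ hΛc) hA3
    v₀ hv₀c hv₀inf

/-- **[IUTchI] Proposition 2.1 AS TYPED, every [SemiAnbd] input BY NAME — WITHOUT Galois domination /
(RF)**: as abc-iut-L5-t11's `prop21_of_chart_of_isProfiniteCompletion` (chart of `π₁^temp(𝒢)`;
`Π̂_𝔾` its profinite completion; `CompactInVerticial`; a verticial family; node data + (A3)), with the
hypothesis `hGal` ("Galois domination with residually finite deck groups", there used only to produce
(RF)) DROPPED: (A0) comes from Galois-countability of the chart via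
`IsTempered.isCompact_comap_of_firstCountable`, and `IsProfiniteCompletion` is used only for the
Hausdorffness of `Π̂_𝔾`. ([IUTchI] Prop 2.1 p.45) [claim: Mochizuki2012, status: disputed] -/
theorem prop21_of_chart_of_isProfiniteCompletion' {𝒢 : ProfiniteSemiGraph.{u}} (c : TemperedPiChart 𝒢)
    (e : D.Tp ≃ₜ* c.G) (h𝒢 : 𝒢.Thm37Hypotheses) (hCV : CompactInVerticial.{u})
    (hPC : IsProfiniteCompletion
      ({ toMonoidHom := D.ι, continuous_toFun := D.ι_continuous } : D.Tp →ₜ* D.Hat))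
    (Λv : 𝒢.graph.Vertex → Subgroup D.Tp)
    (hΛv : ∀ v, (Λv v).map (e : D.Tp →* c.G) ∈ verticialSubgroups c v)
    {E : Type*} (src tgt : E → 𝒢.graph.Vertex) (c₁ c₂ : E → D.Tp)
    (hA3 : ∀ (v w : 𝒢.graph.Vertex) (g h : D.Hat),
      MulAut.conj g • (Λv v).map D.ι ⊓ MulAut.conj h • (Λv w).map D.ι ≠ ⊥ →
        (v = w ∧ g⁻¹ * h ∈ (Λv v).map D.ι) ∨
        ∃ (e : E) (k : D.Hat), ∃ p ∈ (Λv (src e)).map D.ι, ∃ q ∈ (Λv (tgt e)).map D.ι,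
          (src e = v ∧ tgt e = w ∧ g = k * D.ι (c₁ e) * p ∧ h = k * D.ι (c₂ e) * q) ∨
          (src e = w ∧ tgt e = v ∧ h = k * D.ι (c₁ e) * p ∧ g = k * D.ι (c₂ e) * q)) :
    D.ProfiniteConjugatesOfCompactSubgroups := by
  haveI : T2Space D.Hat := hPC.t2Space
  exact D.prop21_of_chart' c e h𝒢 hCV Λv hΛv src tgt c₁ c₂ hA3

/-- **[IUTchI] Proposition 2.2 ("`Π^tp_𝔾` commensurably terminal in `Π̂_𝔾`"), every [SemiAnbd] input BY
NAME — WITHOUT Galois domination / (RF)**: as `tp_isCommensurablyTerminal_of_chart_of_isProfiniteCompletion`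
with `hGal` dropped. ([IUTchI] Prop 2.2 p.45) [claim: Mochizuki2012, status: disputed] -/
theorem tp_isCommensurablyTerminal_of_chart_of_isProfiniteCompletion' {𝒢 : ProfiniteSemiGraph.{u}}
    (c : TemperedPiChart 𝒢) (e : D.Tp ≃ₜ* c.G) (h𝒢 : 𝒢.Thm37Hypotheses)
    (hCV : CompactInVerticial.{u}) (hVI : VerticialInjective.{u})
    (hPC : IsProfiniteCompletion
      ({ toMonoidHom := D.ι, continuous_toFun := D.ι_continuous } : D.Tp →ₜ* D.Hat))
    (Λv : 𝒢.graph.Vertex → Subgroup D.Tp)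
    (hΛv : ∀ v, (Λv v).map (e : D.Tp →* c.G) ∈ verticialSubgroups c v)
    {E : Type*} (src tgt : E → 𝒢.graph.Vertex) (c₁ c₂ : E → D.Tp)
    (hA3 : ∀ (v w : 𝒢.graph.Vertex) (g h : D.Hat),
      MulAut.conj g • (Λv v).map D.ι ⊓ MulAut.conj h • (Λv w).map D.ι ≠ ⊥ →
        (v = w ∧ g⁻¹ * h ∈ (Λv v).map D.ι) ∨
        ∃ (e : E) (k : D.Hat), ∃ p ∈ (Λv (src e)).map D.ι, ∃ q ∈ (Λv (tgt e)).map D.ι,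
          (src e = v ∧ tgt e = w ∧ g = k * D.ι (c₁ e) * p ∧ h = k * D.ι (c₂ e) * q) ∨
          (src e = w ∧ tgt e = v ∧ h = k * D.ι (c₁ e) * p ∧ g = k * D.ι (c₂ e) * q)) :
    IsCommensurablyTerminal D.ι.range := by
  haveI : T2Space D.Hat := hPC.t2Space
  exact D.tp_isCommensurablyTerminal_of_chart' c e h𝒢 hCV hVI Λv hΛv src tgt c₁ c₂ hA3

end TemperedGraphGroupData

end Literature.IUT.HodgeTheaters

end
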